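import Summits.HodgeConjecture.HodgeConjecture.Theorems.K2E3WittLeviCartanRecursionKernel   -- p856… (this seat): the `m`-general recursion modulo `hrawW`
import Summits.HodgeConjecture.HodgeConjecture.Theorems.K2E3WittLeviCartanTameRamified      -- ★ p856509 (K2E3-p09): §1 tools (`mem_center_wittLevi_of_diagonal'`, `v_coe_wittCoweight_eq`, …); brings ★ ConeCentre
import Summits.HodgeConjecture.HodgeConjecture.Theorems.K2E3WittLeviConeCentreKernel        -- (this seat): mirror labels ∕ block constancy for any kernel
import HarnessLib

/-!
# `hcartanLevi(S)` for `U(σ, wittFormOn e Han)` with ANY anisotropic kernel and ANY isometric involution, modulo the Cartan letter `hrawW`: the cone × centre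
# packaging of the `m`-general recursion (crux H413, 13a road A′, `m = 2`; W7 part 2)

Cell `hodgecm-mathlib`, Track B, line `K2_E3_EllipticInputs`, row 13a; seat K2E3-p10 (g3) (road-A line lead).  THEOREMS ONLY; count-neutral helper
(`--supports stmt-HodgeConjecture-24833 --as helper`).  §2 is K2E3-p09 (g3)'s ★ `exists_leviCartan_tame` (p856509) adapted to an arbitrary kernel: no transport to
`U(σ, J₀)` (the recursion ★ `exists_leviIntegral_mul_diagonalGL_mul_kernel` lives in `U(σ, W)` itself), the kernel slots carry `d = c = z = u = 1`, the `rev`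
involution permutes the kernel slots (`rev_apply_inr_inl'`), and the diagonal factors are `W`-unitary by ★ `glDiagonal_mem_unitaryGroupOfForm` (hyperbolic pairs by
the norm condition, kernel block by `≡ 1`).

* (tools: ★ `K2E3WittLeviConeCentreKernel` — `rev_apply_inr_inl'`, `wittBlockOn_rev'`, `const_on_blocks_of_steps'`, any `m`.)
* **`exists_leviCartan_kernel`** — `hrawW ⟹ hcartanLevi(S)` in the FROZEN shape of ★ `K2E3WittLeviCuspidalDichotomyOfCartan` with `K₀ = unitaryInt σ W`, every `S`,
  ANY `m`: the `hLevi` letters of ★ p856653 `isAdmissible_irrClass_of_wittCartan_compactSet` with `Ω = K₀` (read `k ∈ K₀.subgroupOf M_S` as `(k : U) ∈ K₀`).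

With ★ p856719 (K2E3-p23, Witt–Iwasawa = `hGC` for a NORMALISED kernel), the `hG` letter (the same packaging at `S = univ`, or ★ `K2E3WittCartanOfRawCartan`'s pattern)
and `hrawW` (K2E3-p23 (D3) ∕ K2E3-p09 (T2)), ★ p856653 closes row 13a at the `m = 2` places.  HONEST LABEL: conditional on `hrawW`; HC_CM is proved only modulo
the 7 printed citations (2 remaining named inputs: hLiu418 = stmt-HodgeConjecture-24832, h413 = stmt-HodgeConjecture-24833) until rung 0 closes.

References: Bruhat–Tits (1972) (4.4.3); Tits (1979) §3.3.3; Casselman (1995) §6.3; Borel (1991) §23; Bernstein–Zelevinsky (1977) §2.1; Jacobowitz (1962) §§7–8.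
-/

set_option autoImplicit false
set_option linter.dupNamespace false

noncomputable section

open scoped Valued WithZero Matrix MatrixGroups
open Matrix

namespace Summit.HodgeConjecture.HodgeConjecture.Cruxes.H413.K2E3WittLeviCartanKernel

open Literature.NumberTheory.Automorphic Literature.NumberTheory.Automorphic.UnitaryGroup Literature.NumberTheory.Automorphic.HermitianLattice
open Literature.NumberTheory.Automorphic.CartanUnique
open K2E3LocalUnitaryWitt K2E3WittStandardIndexing K2E3WittConeContraction K2E3WittCartanUnramified K2E3WittLeviCuspidalDichotomyOfCartan
  K2E3WittLeviCartanBlocks K2E3WittLeviCartanLabels K2E3WittLeviConeCentre K2E3WittLeviCartanRecursionTame K2E3WittLeviCartanTameRamified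
  K2E3WittParabolicBlocks K2E3WittParabolicBlocksLift K2E3WittLeviCartanRecursionKernel K2E3WittLeviConeCentreKernel

/-! ## §2 `hcartanLevi(S)` for any kernel, modulo `hrawW` -/

section Main

variable {K : Type*} [Field K] [Valued K ℤᵐ⁰] [ValuativeRel K] [(Valued.v : Valuation K ℤᵐ⁰).Compatible]
  [IsPrincipalIdealRing (Valued.v (R := K)).valuationSubring] {σ : K →+* K} {ϖ : K} {m : ℕ} {Han : Matrix (Fin m) (Fin m) K}

/-- **THE LEVI CARTAN DECOMPOSITION OVER THE `S`-CONE for ANY kernel, modulo `hrawW`** — the `hcartanLevi(S)` input of ★ `K2E3WittLeviCuspidalDichotomyOfCartan`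
(frozen shape), every `S ⊆ Fin r`: `g = k₁ · ∏_{β ∈ S} a_β(ϖ)^{n β} · k₂ · z`, `k₁, k₂ ∈ K₀ ∩ M_S`, `z ∈ Z(M_S)` (★ K2E3-p09's `exists_leviCartan_tame` for any `m`).
[cite: BruhatTits1972, (4.4.3)] [cite: Tits1979, §3.3.3] [cite: Casselman1995, §6.3] -/
theorem exists_leviCartan_kernel (hσ : ∀ x, σ (σ x) = x) (hvσ : ∀ x, Valued.v (σ x) = Valued.v x)
    (hϖ : Valued.v ϖ = WithZero.exp (-1 : ℤ)) (hHan : IsUnit Han.det)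
    (hrawW : ∀ (r' N' : ℕ) (e' : WittIndex r' m ≃ Fin N')
      (_hstd' : ∀ x, (e' x).val = Sum.elim (fun i : Fin r' => i.val) (Sum.elim (fun u : Fin m => r' + u.val) (fun j : Fin r' => r' + m + j.val)) x)
      (g : GL (Fin N') K), g ∈ unitaryGroupOfForm σ (wittFormOn e' Han) →
      ∃ k₁ k₂ : GL (Fin N') K, k₁ ∈ unitaryGroupOfForm σ (wittFormOn e' Han) ∧
        (∀ i j, Valued.v ((k₁ : Matrix (Fin N') (Fin N') K) i j) ≤ 1) ∧ (∀ i j, Valued.v (((k₁⁻¹ : GL (Fin N') K) : Matrix (Fin N') (Fin N') K) i j) ≤ 1) ∧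
        k₂ ∈ unitaryGroupOfForm σ (wittFormOn e' Han) ∧
        (∀ i j, Valued.v ((k₂ : Matrix (Fin N') (Fin N') K) i j) ≤ 1) ∧ (∀ i j, Valued.v (((k₂⁻¹ : GL (Fin N') K) : Matrix (Fin N') (Fin N') K) i j) ≤ 1) ∧
        ∃ (d : Fin N' → K) (E : Fin N' → ℤ), ((k₁ * g * k₂ : GL (Fin N') K) : Matrix (Fin N') (Fin N') K) = Matrix.diagonal d ∧
          (∀ i, σ (d i) * d (Fin.rev i) = 1) ∧ (∀ u : Fin m, d (e' (Sum.inr (Sum.inl u))) = 1) ∧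
          (∀ k, Valued.v (d k) = WithZero.exp (-E k)) ∧ (∀ i j : Fin N', i ≤ j → E j ≤ E i))
    {N r : ℕ} (e : WittIndex r m ≃ Fin N)
    (hstd : ∀ x, (e x).val = Sum.elim (fun i : Fin r => i.val) (Sum.elim (fun u : Fin m => r + u.val) (fun j : Fin r => r + m + j.val)) x)
    (S : Finset (Fin r)) (g : ↥(wittLevi σ (wittFormOn e Han) e S)) :
    ∃ k₁ ∈ (unitaryInt σ (wittFormOn e Han)).subgroupOf (wittLevi σ (wittFormOn e Han) e S),
    ∃ k₂ ∈ (unitaryInt σ (wittFormOn e Han)).subgroupOf (wittLevi σ (wittFormOn e Han) e S), ∃ n : ↥S → ℕ,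
    ∃ z ∈ Subgroup.center ↥(wittLevi σ (wittFormOn e Han) e S),
      g = k₁ * Finset.univ.noncommProd
        (fun β : ↥S => (⟨wittCocharacter σ hσ e Han β (Units.mk0 ϖ (uniformizer_ne_zero hϖ)),
          wittCocharacter_mem_wittLevi σ hσ e Han β (Units.mk0 ϖ (uniformizer_ne_zero hϖ)) S⟩ : ↥(wittLevi σ (wittFormOn e Han) e S)) ^ n β)
        (fun β _ β' _ _ => (commute_wittCocharacter_levi σ hσ e Han β β' (Units.mk0 ϖ (uniformizer_ne_zero hϖ)) S).pow_pow (n β) (n β')) * k₂ * z := by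
  have hϖ0 : ϖ ≠ 0 := uniformizer_ne_zero hϖ
  have hσϖ0 : σ ϖ ≠ 0 := (map_ne_zero σ).2 hϖ0
  have hϖσ : Valued.v (σ ϖ) = WithZero.exp (-1 : ℤ) := (hvσ ϖ).trans hϖ
  have hN : N = r + (m + r) := by simpa using (Fintype.card_congr e).symm
  have hWdet : (wittFormOn e Han).det ≠ 0 := det_wittFormOn_ne_zero e hHan
  -- Step 1: the diagonal form in `U(σ, W)` (the recursion `K2E3WittLeviCartanRecursionKernel`)
  obtain ⟨k₁A, k₂A, hk₁i, hk₁L, hk₂i, hk₂L, d, E, hdn, hdker, hdv, hEanti, hErev, hgeq⟩ :=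
    exists_leviIntegral_mul_diagonalGL_mul_kernel hσ hvσ hϖ hHan hrawW r e hstd S g.1 ((mem_wittLevi_iff _).1 g.2)
  -- Step 2: the exponents `n β = (E(e_β) − E(e_{β+1}))⁺`
  obtain ⟨n, hn⟩ : ∃ n : ↥S → ℕ, n = fun β : ↥S => (E (e (Sum.inl (β : Fin r))) -
      (if h : (β : Fin r).val + 1 < r then E (e (Sum.inl ⟨(β : Fin r).val + 1, h⟩)) else 0)).toNat := ⟨_, rfl⟩
  -- the steps are non-negative: across `β ∈ S` the labels of `e_β, e_{β+1}` agree
  have hstep : ∀ (t : ℕ) (ht : t + 1 < r), (⟨t, by omega⟩ : Fin r) ∈ S →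
      E (e (Sum.inl ⟨t + 1, ht⟩)) ≤ E (e (Sum.inl ⟨t, by omega⟩)) := by
    intro t ht htS
    refine hEanti _ _ (Fin.ext ?_) (Fin.le_iff_val_le_val.2 (by rw [hstd, hstd]; simp))
    change wittBlockNat S (e.symm (e (Sum.inl ⟨t, _⟩))) = wittBlockNat S (e.symm (e (Sum.inl ⟨t + 1, ht⟩)))
    rw [e.symm_apply_apply, e.symm_apply_apply]
    by_contra hne
    have hlt : wittBlockNat (m := m) S (Sum.inl ⟨t, by omega⟩) < wittBlockNat (m := m) S (Sum.inl ⟨t + 1, ht⟩) :=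
      lt_of_le_of_ne (wittBlockNat_mono_pos S (by change t ≤ t + 1; omega)) hne
    change ((Finset.univ \ S).filter fun α => α.val < t).card < ((Finset.univ \ S).filter fun α => α.val < t + 1).card at hlt
    obtain ⟨α, hα, hαnot⟩ := Finset.exists_mem_notMem_of_card_lt_card hlt
    simp only [Finset.mem_filter, Finset.mem_sdiff, Finset.mem_univ, true_and, not_and, not_lt] at hα hαnot
    have hαt : α.val = t := by have := hαnot hα.1; omega
    exact hα.1 (by rw [show α = ⟨t, by omega⟩ from Fin.ext hαt]; exact htS)
  have hlast : ∀ (hr : 0 < r), (⟨r - 1, by omega⟩ : Fin r) ∈ S → 0 ≤ E (e (Sum.inl ⟨r - 1, by omega⟩)) := by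
    intro hr hS
    have hle : e (Sum.inl ⟨r - 1, by omega⟩) ≤ Fin.rev (e (Sum.inl ⟨r - 1, by omega⟩)) := by
      rw [Fin.le_iff_val_le_val, Fin.val_rev, hstd]; simp only [Sum.elim_inl]; omega
    have hlab : wittBlockOn e S (e (Sum.inl ⟨r - 1, by omega⟩)) = wittBlockOn e S (Fin.rev (e (Sum.inl ⟨r - 1, by omega⟩))) := by
      rw [wittBlockOn_rev' e S hstd]
      apply Fin.ext
      rw [Fin.val_rev]
      change wittBlockNat S (e.symm (e (Sum.inl _))) = 2 * (Finset.univ \ S).card + 1 - (wittBlockNat S (e.symm (e (Sum.inl _))) + 1)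
      rw [e.symm_apply_apply]
      have hL : wittBlockNat (m := m) S (Sum.inl ⟨r - 1, by omega⟩) = (Finset.univ \ S).card := by
        change ((Finset.univ \ S).filter fun α => α.val < r - 1).card = (Finset.univ \ S).card
        rw [Finset.card_filter_eq_iff]
        intro α hα
        rw [Finset.mem_sdiff] at hα
        have : α ≠ ⟨r - 1, by omega⟩ := fun h => hα.2 (h ▸ hS)
        have h2 : α.val ≠ r - 1 := fun h => this (Fin.ext h)
        have := α.isLt; omega
      rw [hL]; omega
    have h := hEanti _ _ hlab hle
    rw [hErev] at h
    omega
  -- Step 3: the cone exponent `G` and `F = E − G`, constant on the `S`-blocks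
  obtain ⟨G, hG⟩ : ∃ G : Fin N → ℤ, G = fun k => Sum.elim (fun t : Fin r => ((∑ β : ↥S, if t.val ≤ (β : Fin r).val then n β else 0 : ℕ) : ℤ))
      (Sum.elim (fun _ : Fin m => (0 : ℤ)) (fun j : Fin r => -((∑ β : ↥S, if (Fin.rev j).val ≤ (β : Fin r).val then n β else 0 : ℕ) : ℤ)))
      (e.symm k) := ⟨_, rfl⟩
  have hEmid : ∀ u : Fin m, E (e (Sum.inr (Sum.inl u))) = 0 := fun u => by
    have h := hdv (e (Sum.inr (Sum.inl u)))
    rw [hdker u, Units.val_one, map_one, ← WithZero.exp_zero, WithZero.exp_inj] at h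
    omega
  have hGrev : ∀ k, G (Fin.rev k) = -G k := fun k => by
    obtain ⟨x, rfl⟩ := e.surjective k
    rw [hG]; dsimp only
    rcases x with t | u | j
    · rw [rev_apply_inl e hstd, e.symm_apply_apply, e.symm_apply_apply]; simp only [Sum.elim_inr, Sum.elim_inl, Fin.rev_rev]
    · rw [rev_apply_inr_inl' e hstd, e.symm_apply_apply, e.symm_apply_apply]; simp
    · rw [rev_apply_inr_inr e hstd, e.symm_apply_apply, e.symm_apply_apply]; simp only [Sum.elim_inr, Sum.elim_inl, neg_neg]
  have hFrev : ∀ k, E (Fin.rev k) - G (Fin.rev k) = -(E k - G k) := fun k => by rw [hErev, hGrev]; ring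
  have hF1 : ∀ (t : ℕ) (ht : t + 1 < r), (⟨t, by omega⟩ : Fin r) ∈ S →
      E (e (Sum.inl ⟨t, by omega⟩)) - G (e (Sum.inl ⟨t, by omega⟩)) = E (e (Sum.inl ⟨t + 1, ht⟩)) - G (e (Sum.inl ⟨t + 1, ht⟩)) := by
    intro t ht htS
    have hs := sum_cone_step S n t (by omega)
    rw [dif_pos htS] at hs
    have hnt : (n ⟨⟨t, by omega⟩, htS⟩ : ℤ) = E (e (Sum.inl ⟨t, by omega⟩)) - E (e (Sum.inl ⟨t + 1, ht⟩)) := by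
      rw [hn]; dsimp only; rw [dif_pos ht, Int.toNat_of_nonneg (sub_nonneg.2 (hstep t ht htS))]
    rw [hG]; dsimp only; rw [e.symm_apply_apply, e.symm_apply_apply]; simp only [Sum.elim_inl]
    rw [hs]; push_cast; rw [hnt]; ring
  have hF2 : ∀ (hr : 0 < r), (⟨r - 1, by omega⟩ : Fin r) ∈ S →
      E (e (Sum.inl ⟨r - 1, by omega⟩)) - G (e (Sum.inl ⟨r - 1, by omega⟩)) = 0 := by
    intro hr hS
    have hs := sum_cone_step S n (r - 1) (by omega)
    rw [dif_pos hS] at hs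
    have hzero : (∑ β : ↥S, if r - 1 + 1 ≤ (β : Fin r).val then n β else 0) = 0 :=
      Finset.sum_eq_zero fun β _ => if_neg (by have := (β : Fin r).isLt; omega)
    have hnt : (n ⟨⟨r - 1, by omega⟩, hS⟩ : ℤ) = E (e (Sum.inl ⟨r - 1, by omega⟩)) := by
      rw [hn]; dsimp only; rw [dif_neg (by omega), sub_zero, Int.toNat_of_nonneg (hlast hr hS)]
    rw [hG]; dsimp only; rw [e.symm_apply_apply]; simp only [Sum.elim_inl]
    rw [hs, hzero, add_zero, hnt, sub_self]
  have hF3 : ∀ u : Fin m, E (e (Sum.inr (Sum.inl u))) - G (e (Sum.inr (Sum.inl u))) = 0 := fun u => by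
    rw [hG]; dsimp only; rw [e.symm_apply_apply]; simp only [Sum.elim_inr, Sum.elim_inl]; rw [hEmid, sub_zero]
  have hconst := const_on_blocks_of_steps' e S hstd (fun k => E k - G k) hF1 hF2 hF3 hFrev
  -- `F = 0` on the `rev`-fixed slots, and on every block meeting an `e`-index and an `f`-slot
  have hF0 : ∀ k, Fin.rev k = k → E k - G k = 0 := fun k hk => by have h := hFrev k; rw [hk] at h; omega
  have hzero : ∀ i j : Fin N, wittBlockOn e S i = wittBlockOn e S j → i < Fin.rev i → Fin.rev j < j → E i - G i = 0 := by
    intro i j hij hi hj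
    -- `i = e_t`, `j = f`-slot `j′`
    -- kernel slots: `F = 0` there outright
    by_cases hker : ∃ u, i = e (Sum.inr (Sum.inl u))
    · obtain ⟨u, rfl⟩ := hker; exact hF3 u
    obtain ⟨t, rfl⟩ : ∃ t, i = e (Sum.inl t) := by
      obtain ⟨x, rfl⟩ := e.surjective i
      rcases x with t | u | j₁
      · exact ⟨t, rfl⟩
      · exact absurd ⟨u, rfl⟩ hker
      · exfalso
        rw [rev_apply_inr_inr e hstd, Fin.lt_def, hstd, hstd] at hi
        simp only [Sum.elim_inr, Sum.elim_inl] at hi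
        have := (Fin.rev j₁).isLt; omega
    by_cases hkerj : ∃ u, j = e (Sum.inr (Sum.inl u))
    · obtain ⟨u, rfl⟩ := hkerj; rw [hconst _ _ hij]; exact hF3 u
    obtain ⟨j', rfl⟩ : ∃ j', j = e (Sum.inr (Sum.inr j')) := by
      obtain ⟨y, rfl⟩ := e.surjective j
      rcases y with t' | u | j'
      · exfalso
        rw [rev_apply_inl e hstd, Fin.lt_def, hstd, hstd] at hj
        simp only [Sum.elim_inr, Sum.elim_inl] at hj
        have := (Fin.rev t').isLt; omega
      · exact absurd ⟨u, rfl⟩ hkerj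
      · exact ⟨j', rfl⟩
    have hlab : wittBlockNat (m := m) S (Sum.inl t) = (Finset.univ \ S).card := by
      have h' := congrArg Fin.val hij
      rw [wittBlockOn_apply, wittBlockOn_apply, wittBlock_val, wittBlock_val, e.symm_apply_apply, e.symm_apply_apply] at h'
      exact label_inl_eq_card_of_eq_label_inr_inr S h'
    have hr : 0 < r := Fin.pos t
    have htle : t.val ≤ r - 1 := by have := t.isLt; omega
    have hmemS : (⟨r - 1, by omega⟩ : Fin r) ∈ S := mem_of_wittBlockNat_inl_eq_card S hlab ⟨r - 1, by omega⟩ (Fin.le_iff_val_le_val.2 htle)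
    have hlab' : wittBlockNat (m := m) S (Sum.inl ⟨r - 1, by omega⟩) = (Finset.univ \ S).card :=
      le_antisymm (wittBlockNat_inl_le_card S _) (hlab ▸ wittBlockNat_mono_pos S (by change t.val ≤ r - 1; exact htle))
    have hlabels : wittBlockOn e S (e (Sum.inl t)) = wittBlockOn e S (e (Sum.inl ⟨r - 1, by omega⟩)) := by
      apply Fin.ext
      rw [wittBlockOn_apply, wittBlockOn_apply, wittBlock_val, wittBlock_val, e.symm_apply_apply, e.symm_apply_apply, hlab, hlab']
    rw [hconst _ _ hlabels]
    exact hF2 hr hmemS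
  -- Step 4: the cone element `C`, its units `c` and their valuations ∕ norm relations
  obtain ⟨c, hc⟩ : ∃ c : Fin N → Kˣ, c = fun k => ∏ β : ↥S, (wittCoweight σ (β : Fin r) (Units.mk0 ϖ hϖ0) (e.symm k)) ^ n β := ⟨_, rfl⟩
  have hcval : ∀ k, (c k : K) = ∏ β : ↥S, ((wittCoweight σ (β : Fin r) (Units.mk0 ϖ hϖ0) (e.symm k) : Kˣ) : K) ^ n β := fun k => by
    rw [hc]; push_cast; rfl
  have hC : (((Finset.univ.noncommProd
      (fun β : ↥S => (⟨wittCocharacter σ hσ e Han β (Units.mk0 ϖ hϖ0), wittCocharacter_mem_wittLevi σ hσ e Han β _ S⟩ :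
        ↥(wittLevi σ (wittFormOn e Han) e S)) ^ n β)
      (fun β _ β' _ _ => (commute_wittCocharacter_levi σ hσ e Han β β' _ S).pow_pow (n β) (n β')) :
        ↥(wittLevi σ (wittFormOn e Han) e S)) : ↥(unitaryGroupOfForm σ (wittFormOn e Han))) : GL (Fin N) K) = diagonalGL (Fin N) K c := by
    refine Units.ext ?_
    rw [coe_noncommProd_levi, coe_diagonalGL]
    congr 1
    funext k
    rw [hcval]
  have hcv : ∀ k, Valued.v (c k : K) = WithZero.exp (-G k) := fun k => by
    rw [hcval, map_prod]
    have h1 : ∏ β : ↥S, Valued.v (((wittCoweight σ (β : Fin r) (Units.mk0 ϖ hϖ0) (e.symm k) : Kˣ) : K) ^ n β) =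
        ∏ β : ↥S, Valued.v (((wittCoweight (RingHom.id K) (β : Fin r) (Units.mk0 ϖ hϖ0) (e.symm k) : Kˣ) : K) ^ n β) :=
      Finset.prod_congr rfl fun β _ => by rw [map_pow, map_pow, v_coe_wittCoweight_eq σ hvσ]
    rw [h1, ← map_prod, prod_levi_coweight_pow_eq_zpow (RingHom.id K) e S hϖ0 rfl n k, v_uniformizer_zpow hϖ, hG]
  have hcker : ∀ u : Fin m, c (e (Sum.inr (Sum.inl u))) = 1 := fun u => by
    rw [hc]; dsimp only; rw [e.symm_apply_apply]
    exact Finset.prod_eq_one fun β _ => by rw [wittCoweight_inr_inl, one_pow]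
  have hcn : ∀ i, σ (c i) * c (Fin.rev i) = 1 := fun i => by
    by_cases hker : ∃ u, i = e (Sum.inr (Sum.inl u))
    · obtain ⟨u, rfl⟩ := hker
      rw [rev_apply_inr_inl' e hstd, hcker, hcker, Units.val_one, map_one, one_mul]
    have hne : wittForm r Han (e.symm i) (e.symm (Fin.rev i)) ≠ 0 := by
      change wittFormOn e Han i (Fin.rev i) ≠ 0
      obtain ⟨x, rfl⟩ := e.surjective i
      rcases x with t | u | j₁
      · rw [wittFormOn_apply_inl e hstd Han, if_pos rfl]; exact one_ne_zero
      · exact absurd ⟨u, rfl⟩ hker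
      · rw [wittFormOn_apply_inr_inr e hstd Han, if_pos rfl]; exact one_ne_zero
    rw [hcval, hcval, map_prod, ← Finset.prod_mul_distrib]
    refine Finset.prod_eq_one fun β _ => ?_
    rw [map_pow, ← mul_pow, wittCoweight_cancel σ hσ Han (β : Fin r) (Units.mk0 ϖ hϖ0) _ _ hne, one_pow]
  -- the central diagonal `z_F`: `ϖ^F` on the slots `k ≤ rev k`, `(σϖ)^F` on the slots `rev k < k`
  obtain ⟨zc, hzc⟩ : ∃ zc : Fin N → Kˣ, zc = fun k => if k ≤ Fin.rev k then Units.mk0 ϖ hϖ0 ^ (E k - G k)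
      else Units.map (σ : K →* K) (Units.mk0 ϖ hϖ0) ^ (E k - G k) := ⟨_, rfl⟩
  have hσϖval : ((Units.map (σ : K →* K) (Units.mk0 ϖ hϖ0) : Kˣ) : K) = σ ϖ := rfl
  have hzcn : ∀ i, σ (zc i) * zc (Fin.rev i) = 1 := fun i => by
    rw [hzc]; dsimp only
    rcases lt_trichotomy i (Fin.rev i) with hlt | heq | hgt
    · rw [if_pos hlt.le, if_neg (by rw [Fin.rev_rev]; exact not_le.2 hlt), hFrev, Units.val_zpow_eq_zpow_val, Units.val_zpow_eq_zpow_val,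
        Units.val_mk0, hσϖval, map_zpow₀, ← zpow_add₀ hσϖ0, add_neg_cancel, zpow_zero]
    · rw [if_pos heq.le, if_pos (by rw [Fin.rev_rev]; exact heq.ge), hF0 i heq.symm, show E (Fin.rev i) - G (Fin.rev i) = 0 by rw [← heq]; exact hF0 i heq.symm,
        zpow_zero, Units.val_one, map_one, one_mul]
    · rw [if_neg (not_le.2 hgt), if_pos (by rw [Fin.rev_rev]; exact hgt.le), hFrev, Units.val_zpow_eq_zpow_val, Units.val_zpow_eq_zpow_val,
        Units.val_mk0, hσϖval, map_zpow₀, hσ, ← zpow_add₀ hϖ0, add_neg_cancel, zpow_zero]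
  have hzcv : ∀ k, Valued.v (zc k : K) = WithZero.exp (-(E k - G k)) := fun k => by
    rw [hzc]; dsimp only
    split_ifs
    · rw [Units.val_zpow_eq_zpow_val, Units.val_mk0, v_uniformizer_zpow hϖ]
    · rw [Units.val_zpow_eq_zpow_val, hσϖval, v_uniformizer_zpow hϖσ]
  have hzcconst : ∀ i j : Fin N, wittBlockOn e S i = wittBlockOn e S j → (zc i : K) = zc j := by
    intro i j hij
    have hFij : E i - G i = E j - G j := hconst i j hij
    rw [hzc]; dsimp only
    by_cases hi : i ≤ Fin.rev i <;> by_cases hj : j ≤ Fin.rev j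
    · rw [if_pos hi, if_pos hj, hFij]
    · have h0 : E i - G i = 0 := by
        rcases hi.eq_or_lt with heq | hlt
        · exact hF0 i heq.symm
        · exact hzero i j hij hlt (not_le.1 hj)
      rw [if_pos hi, if_neg hj, ← hFij, h0, zpow_zero, zpow_zero]
    · have h0 : E j - G j = 0 := by
        rcases hj.eq_or_lt with heq | hlt
        · exact hF0 j heq.symm
        · exact hzero j i hij.symm hlt (not_le.1 hi)
      rw [if_neg hi, if_pos hj, hFij, h0, zpow_zero, zpow_zero]
    · rw [if_neg hi, if_neg hj, hFij]
  -- the unit diagonal `u = c⁻¹ · d · z_F⁻¹`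
  obtain ⟨u, hu⟩ : ∃ u : Fin N → Kˣ, u = fun k => (c k)⁻¹ * d k * (zc k)⁻¹ := ⟨_, rfl⟩
  have hd3 : d = c * u * zc := by
    funext k
    rw [Pi.mul_apply, Pi.mul_apply, hu]; dsimp only
    rw [← mul_assoc, ← mul_assoc, mul_inv_cancel, one_mul, inv_mul_cancel_right]
  have hun : ∀ i, σ (u i) * u (Fin.rev i) = 1 := fun i => by
    rw [hu]; dsimp only; push_cast
    exact norm_mul_of_norm σ (norm_mul_of_norm σ (norm_inv_of_norm σ (hcn i)) (hdn i)) (norm_inv_of_norm σ (hzcn i))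
  have huv : ∀ k, Valued.v (u k : K) = 1 := fun k => by
    rw [hu]; dsimp only; push_cast
    rw [map_mul, map_mul, map_inv₀, map_inv₀, hcv, hdv, hzcv, ← WithZero.exp_neg, ← WithZero.exp_neg, ← WithZero.exp_add, ← WithZero.exp_add,
      ← WithZero.exp_zero]
    congr 1; ring
  -- Step 5: the elements of `M_S`
  -- kernel slots: `zc = 1` and `u = 1` there (`E = G = 0`, `c = d = 1`)
  have hzcker : ∀ uu : Fin m, zc (e (Sum.inr (Sum.inl uu))) = 1 := fun uu => by
    rw [hzc]; dsimp only
    rw [hF3 uu, zpow_zero, zpow_zero, ite_self]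
  have huker : ∀ uu : Fin m, u (e (Sum.inr (Sum.inl uu))) = 1 := fun uu => by
    rw [hu]; dsimp only; rw [hcker, hdker, hzcker, inv_one, one_mul, one_mul]
  -- a diagonal with the norm condition and `≡ 1` on the kernel slots is `W`-unitary
  have hdiagU : ∀ {x : Fin N → Kˣ}, (∀ i, σ (x i) * x (Fin.rev i) = 1) → (∀ uu : Fin m, x (e (Sum.inr (Sum.inl uu))) = 1) →
      diagonalGL (Fin N) K x ∈ unitaryGroupOfForm σ (wittFormOn e Han) := by
    intro x hxn hxker
    have hD : diagonalGL (Fin N) K x = glDiagonal N K x := Units.ext (by rw [coe_diagonalGL, coe_glDiagonal])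
    rw [hD]
    refine glDiagonal_mem_unitaryGroupOfForm σ (wittFormOn e Han) x fun a b hab => ?_
    obtain ⟨y, rfl⟩ := e.surjective a
    rcases y with i | uu | j
    · rw [wittFormOn_apply_inl e hstd Han] at hab
      by_cases h : b = Fin.rev (e (Sum.inl i))
      · rw [h]; exact hxn _
      · exact absurd (if_neg h) hab
    · rw [wittFormOn_apply_inr_inl e Han] at hab
      obtain ⟨y', rfl⟩ := e.surjective b
      rw [e.symm_apply_apply] at hab
      rcases y' with i' | u' | j'
      · exact absurd rfl hab
      · rw [hxker, hxker, Units.val_one, map_one, one_mul]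
      · exact absurd rfl hab
    · rw [wittFormOn_apply_inr_inr e hstd Han] at hab
      by_cases h : b = Fin.rev (e (Sum.inr (Sum.inr j)))
      · rw [h]; exact hxn _
      · exact absurd (if_neg h) hab
  have hUu : diagonalGL (Fin N) K u ∈ unitaryGroupOfForm σ (wittFormOn e Han) := hdiagU hun huker
  have hUz : diagonalGL (Fin N) K zc ∈ unitaryGroupOfForm σ (wittFormOn e Han) := hdiagU hzcn hzcker
  set uW : ↥(wittLevi σ (wittFormOn e Han) e S) :=
    ⟨⟨diagonalGL (Fin N) K u, hUu⟩, (mem_wittLevi_iff _).2 (diagonalGL_mem_standardLeviGL _ u)⟩ with huW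
  have huWi : (uW : ↥(unitaryGroupOfForm σ (wittFormOn e Han))) ∈ unitaryInt σ (wittFormOn e Han) := by
    refine mem_unitaryInt_of_forall_v_le_one hvσ hWdet fun i j => ?_
    change Valued.v (((diagonalGL (Fin N) K u : GL (Fin N) K) : Matrix (Fin N) (Fin N) K) i j) ≤ 1
    rw [coe_diagonalGL, Matrix.diagonal_apply]
    split_ifs
    · exact (huv _).le
    · rw [map_zero]; exact zero_le_one
  set k₁ : ↥(wittLevi σ (wittFormOn e Han) e S) := ⟨k₁A, (mem_wittLevi_iff _).2 hk₁L⟩ with hk₁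
  set k₂' : ↥(wittLevi σ (wittFormOn e Han) e S) := ⟨k₂A, (mem_wittLevi_iff _).2 hk₂L⟩ with hk₂'
  set z : ↥(wittLevi σ (wittFormOn e Han) e S) :=
    ⟨⟨diagonalGL (Fin N) K zc, hUz⟩, (mem_wittLevi_iff _).2 (diagonalGL_mem_standardLeviGL _ zc)⟩ with hz
  have hzc : z ∈ Subgroup.center ↥(wittLevi σ (wittFormOn e Han) e S) :=
    mem_center_wittLevi_of_diagonal' σ e Han S (fun k => (zc k : K)) z (coe_diagonalGL zc) hzcconst
  refine ⟨k₁, Subgroup.mem_subgroupOf.2 hk₁i, uW * k₂', Subgroup.mem_subgroupOf.2 (Subgroup.mul_mem _ huWi hk₂i), n, z, hzc, ?_⟩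
  -- Step 6: the equation, read on `GL_N(K)`
  refine Subtype.ext (Subtype.ext ?_)
  have hzGL : (((z : ↥(wittLevi σ (wittFormOn e Han) e S)) : ↥(unitaryGroupOfForm σ (wittFormOn e Han))) : GL (Fin N) K) = diagonalGL (Fin N) K zc := rfl
  have huGL : (((uW : ↥(wittLevi σ (wittFormOn e Han) e S)) : ↥(unitaryGroupOfForm σ (wittFormOn e Han))) : GL (Fin N) K) = diagonalGL (Fin N) K u := rfl
  rw [Subgroup.coe_mul, Subgroup.coe_mul, Subgroup.coe_mul, Subgroup.coe_mul, Subgroup.coe_mul, Subgroup.coe_mul, Subgroup.coe_mul, Subgroup.coe_mul,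
    hC, hzGL, huGL]
  change ((g.1 : ↥(unitaryGroupOfForm σ (wittFormOn e Han))) : GL (Fin N) K) =
    (k₁A : GL (Fin N) K) * diagonalGL (Fin N) K c * (diagonalGL (Fin N) K u * (k₂A : GL (Fin N) K)) * diagonalGL (Fin N) K zc
  rw [hgeq, hd3, map_mul, map_mul]
  -- `z_F` is central in `M_S`: it commutes with `k₂`
  have hcomm : (k₂A : GL (Fin N) K) * diagonalGL (Fin N) K zc = diagonalGL (Fin N) K zc * (k₂A : GL (Fin N) K) := by
    have h := (Subgroup.mem_center_iff.1 hzc) k₂'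
    have h' := congrArg (fun x : ↥(wittLevi σ (wittFormOn e Han) e S) => (((x : ↥(unitaryGroupOfForm σ (wittFormOn e Han))) : GL (Fin N) K))) h
    simp only [Subgroup.coe_mul] at h'
    exact h'
  calc (k₁A : GL (Fin N) K) * (diagonalGL (Fin N) K c * diagonalGL (Fin N) K u * diagonalGL (Fin N) K zc) * (k₂A : GL (Fin N) K)
      = (k₁A : GL (Fin N) K) * diagonalGL (Fin N) K c * diagonalGL (Fin N) K u * (diagonalGL (Fin N) K zc * (k₂A : GL (Fin N) K)) := by
        simp only [mul_assoc]
    _ = (k₁A : GL (Fin N) K) * diagonalGL (Fin N) K c * diagonalGL (Fin N) K u * ((k₂A : GL (Fin N) K) * diagonalGL (Fin N) K zc) := by rw [hcomm]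
    _ = (k₁A : GL (Fin N) K) * diagonalGL (Fin N) K c * (diagonalGL (Fin N) K u * (k₂A : GL (Fin N) K)) * diagonalGL (Fin N) K zc := by
        simp only [mul_assoc]


end Main

end Summit.HodgeConjecture.HodgeConjecture.Cruxes.H413.K2E3WittLeviCartanKernel

end
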